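import Summits.HodgeConjecture.HodgeConjecture.Theorems.AnchorTransportVariationalHodgePadicGenericPropagationProper
import Summits.HodgeConjecture.HodgeConjecture.Theorems.AnchorTransportVariationalHodgePadicDescent
import Summits.HodgeConjecture.HodgeConjecture.Theorems.AnchorTransportVariationalHodgeCurveBase
import Summits.HodgeConjecture.HodgeConjecture.Theorems.Ring2HypothesesFlatSectionsOfCurveBase
import Literature.AlgebraicGeometry.Motives.CurveThroughTwoPointsProofs
import Literature.AlgebraicGeometry.Crystalline.BlochEsnaultKerzLifting

/-!
# Route AnchorTransport — crux `VariationalHodge` (stmt-HodgeConjecture-1076), line `padic-disc-transport`: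
# the registered composition IN THE KERNEL — `P ∧ S ⟹ VariationalHodge` (the crux by name, no residual binder)

HONEST FRAMING: research route conditional on HC_CM; not a corollary; Q11.4-sentence-2 already refuted in dim ≥ 3.
Helper file on the crux item (nothing here closes it; no definition, no named fact, no `sorry`;
`HC_CM` does not occur). Cell `pub-hodge-ring2`, binder seat `ring2-b03` (gen 37), BINDER-OWNERS row b03.

The registered skeleton `Cruxes/VariationalHodge/Lines/padic_disc_transport.lean` (crux-strategist
`cstrat-stmt-HodgeConjecture-1076-p1`, 2026-08-17; skeleton sha `71fbd895aef2…`) composes its four stubs as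
`VariationalHodge_of : D → G → P → S → VariationalHodge`. Two of the four are now kernel terms with the
registered binders VERBATIM:

* STUB D (`Descent`) = `Theorems.curveResidual_of_variationalHodgeDescended` (seat ring2-b03 gen 30);
* STUB G (`GenericPropagation`) = `Theorems.genericPropagation` (gen 34; NO quasi-projectivity binder — the
  curve road: Mumford curve through two parameter points, dominant pieces flat over the base curve).

This file runs the skeleton's composition against those two terms, so that the crux BY NAME —
`Summit.HodgeConjecture.HodgeConjecture.Theses.AnchorTransport.VariationalHodge` — follows from the line's two
ARITHMETIC stubs alone, copied verbatim as hypotheses (the skeleton's local `def`s are not importable under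
`Theorems/`): the research bet P (`PadicDiscTransport.PadicImageAlgebraization`: the `K₀`-form of
Antieau–Mathew–Morrow–Nikolaus 2022 Conj. 1.3 / Bloch–Esnault–Kerz 2014 Conj. 1.2, research-OPEN, typed on
the tree's real carriers `KTheory.KZeroRat`, `KTheory.ContinuousKZeroRat`, `WittScheme.IsSmoothProperModel`) and
the arithmetic disc S (`PadicDiscTransport.ArithmeticDiscSupply`, the Maulik–Poonen residue disc; its
C-free part is in the kernel on quasi-projective carriers, gens 33–36, and it is reduced there to the
crystalline TRANSPORT `T` of `AnchorTransportVariationalHodgePadicTransportReduction`).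

* `variationalHodgeDescended_of_padic` — **G + P + S ⟹ the descended crux** (the skeleton's
  `variationalHodgeDescended_of`, verbatim, with `hG := genericPropagation`);
* `curveResidual_of_padic` — **⟹ the crux over smooth irreducible affine CURVES** (STUB D's term);
* `variationalHodge_of_padic` — **P ∧ S ⟹ `Theses.AnchorTransport.VariationalHodge`**, the route decl by
  name, through the route's unconditional reduction `variationalHodge_of_curveBase` with Mumford's curve
  lemma discharged (`Motives.mumford_smoothCurve_through_two_points_holds`). Compared with gen 32's
  `variationalHodge_quasiProjective_of_padic` / `variationalHodgeQP_of_padic` the binder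
  `IsQuasiProjectiveOver 𝒳` is GONE: the edge «row b03 ⟸ {AMMN 2022 Conj. 1.3 (`K₀`-form), arithmetic
  disc}» of `BINDER-OWNERS.md` now holds for the UNRESTRICTED row (proper `f`, every smooth irreducible
  base), not only for its printed quasi-projective form — the `hqp` residual does not enter this edge;
* `flatSectionsAlgebraic_of_padic` — **P ∧ S ⟹ `Ring2.Hypotheses.FlatSectionsAlgebraic`** (row b04,
  Charles–Schnell Conj. 11.3.1 in flat-section form, every base), through the binder-free
  `Ring2.Hypotheses.flatSectionsAlgebraic_of_vhc` (seat ring2-b04).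

What is NOT claimed: neither P nor S is proved here (P is an open conjecture; of S only the C-free
arithmetic disc is in the kernel, on quasi-projective carriers); no case of the Hodge conjecture and no
case of the variational Hodge conjecture is proved — an implication between typed inputs is.

References: [MaulikPoonen2012] §3–4; [AntieauMathewMorrowNikolaus2022] Conj. 1.3, Question 1.4, Thm. D;
[BlochEsnaultKerz2014pAdic] Conj. 1.2, Thm. 1.3; [CharlesSchnell2014Notes] Conj. 11.3.1, Prop. 11.3.5,
Prop. 11.3.11; [EGAIV3] Thm. 8.8.2; [MumfordAV1970] §6 Lemma.
-/

noncomputable section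

-- every declaration of this problem lives in `Summit.HodgeConjecture.HodgeConjecture.…` (summit = sub-problem)
set_option linter.dupNamespace false

open CategoryTheory AlgebraicGeometry TopologicalSpace
open Literature.AlgebraicGeometry.Motives Literature.AlgebraicGeometry.HodgeTheory
open Literature.AlgebraicGeometry.KTheory Literature.AlgebraicGeometry.Crystalline
open Summit.HodgeConjecture.HodgeConjecture.Theses.AnchorTransport
open scoped Isocrystal

namespace Summit.HodgeConjecture.HodgeConjecture.Theorems

section Padic

-- Hypotheses P (`PadicDiscTransport.PadicImageAlgebraization`, with `ProClassAlgebraizes` unfolded) and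
-- S (`PadicDiscTransport.ArithmeticDiscSupply`, with `IsGenericPoint` / `ProClassAlgebraizes` unfolded) of the
-- registered skeleton, verbatim (the same binders as in `AnchorTransportVariationalHodgePadicQPComposition`).
variable
  (hP : ∀ d : ℕ, ∃ p₀ : ℕ, ∀ (p : ℕ) [Fact p.Prime], p₀ ≤ p →
    ∀ (κ : Type) [Field κ] [CharP κ p] [PerfectRing κ p] [IsAlgClosed κ] [Algebra (ZMod p) κ],
    Algebra.IsAlgebraic (ZMod p) κ →
    ∀ (𝒴 : SchemeOver (WittVector p κ)), WittScheme.IsSmoothProperModel d 𝒴 →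
    ∀ ξ : ContinuousKZeroRat (Ideal.span {(p : WittVector p κ)}) 𝒴,
      ∃ η : KZeroRat 𝒴.left,
        KZeroRat.map (WittScheme.specialFibreι 𝒴) η =
          KZeroRat.map (specialFibreToTower 𝒴)
            (ContinuousKZeroRat.specialFibre (Ideal.span {(p : WittVector p κ)}) 𝒴 ξ))
  (hS : ∀ (N : ℕ) (k : Type) [Field k] [Countable k] (σ : k →+* ℂ) ⦃n : ℕ⦄ ⦃𝒳₀ S₀ : SchemeOver k⦄
    (f₀ : 𝒳₀ ⟶ S₀),
    IsSmoothProjectiveFamily ((baseChangeHom σ).map f₀) n →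
    IrreducibleSpace ((baseChangeHom σ).obj S₀).left → IsAffine ((baseChangeHom σ).obj S₀).left →
    AlgebraicGeometry.Smooth ((baseChangeHom σ).obj S₀).hom →
    topologicalKrullDim ((baseChangeHom σ).obj S₀).left = 1 →
    ∀ (p : ℕ) (A : complexBetti ((baseChangeHom σ).obj 𝒳₀) (2 * p)),
    (∀ s : ComplexPoints ((baseChangeHom σ).obj S₀),
      IsRationalClass (complexBetti.map (fiberι ((baseChangeHom σ).map f₀) s) (2 * p) A) ∧
      IsOfHodgeType n (fiberOver ((baseChangeHom σ).map f₀) s) (2 * p) p p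
        (complexBetti.map (fiberι ((baseChangeHom σ).map f₀) s) (2 * p) A)) →
    ∀ s₀ : ComplexPoints ((baseChangeHom σ).obj S₀),
      complexBetti.map (fiberι ((baseChangeHom σ).map f₀) s₀) (2 * p) A ∈
        algebraicClasses (fiberOver ((baseChangeHom σ).map f₀) s₀) p →
    ∃ (q : ℕ) (_ : Fact q.Prime) (κ : Type) (_ : Field κ) (_ : CharP κ q) (_ : PerfectRing κ q)
      (_ : IsAlgClosed κ) (_ : Algebra (ZMod q) κ) (_ : Algebra.IsAlgebraic (ZMod q) κ)
      (𝒴 : SchemeOver (WittVector q κ))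
      (ξ : ContinuousKZeroRat (Ideal.span {(q : WittVector q κ)}) 𝒴)
      (s : ComplexPoints ((baseChangeHom σ).obj S₀)) (ι : K(q, κ) →+* ℂ),
      N ≤ q ∧ WittScheme.IsSmoothProperModel n 𝒴 ∧
      (∀ Z : Set (ComplexPoints ((baseChangeHom σ).obj S₀)),
        IsDefinedOver σ S₀ σ.fieldRange Z → s ∈ Z → Z = Set.univ) ∧
      Nonempty ((baseChangeHom ι).obj (WittScheme.genericFibre 𝒴) ≅
        fiberOver ((baseChangeHom σ).map f₀) s) ∧
      ((∃ η : KZeroRat 𝒴.left,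
        KZeroRat.map (WittScheme.specialFibreι 𝒴) η =
          KZeroRat.map (specialFibreToTower 𝒴)
            (ContinuousKZeroRat.specialFibre (Ideal.span {(q : WittVector q κ)}) 𝒴 ξ)) →
        complexBetti.map (fiberι ((baseChangeHom σ).map f₀) s) (2 * p) A ∈
          algebraicClasses (fiberOver ((baseChangeHom σ).map f₀) s) p))

include hP hS

/-- **G + P + S ⟹ the descended crux** — the skeleton's `variationalHodgeDescended_of` with STUB G supplied
by the kernel term `genericPropagation` (registered binders verbatim, no quasi-projectivity hypothesis):
take the bet's bound `p₀` for relative dimension `n`; the arithmetic disc supplies `q ≥ p₀`, a model `𝒴`,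
a pro-class `ξ̂` and a `k`-generic point `s`; the bet algebraizes `ξ̂|_{Y_κ}`, so `A|_{X_s}` is algebraic;
propagation from the `k`-generic fibre gives every fibre.
[cite: MaulikPoonen2012, §3–4] [cite: AntieauMathewMorrowNikolaus2022, Conj. 1.3 and Thm. D]
[cite: CharlesSchnell2014Notes, Prop. 11.3.11] -/
theorem variationalHodgeDescended_of_padic (k : Type) [Field k] [Countable k] (σ : k →+* ℂ) ⦃n : ℕ⦄
    ⦃𝒳₀ S₀ : SchemeOver k⦄ (f₀ : 𝒳₀ ⟶ S₀)
    (hf : IsSmoothProjectiveFamily ((baseChangeHom σ).map f₀) n)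
    (hirr : IrreducibleSpace ((baseChangeHom σ).obj S₀).left)
    (haff : IsAffine ((baseChangeHom σ).obj S₀).left)
    (hsm : AlgebraicGeometry.Smooth ((baseChangeHom σ).obj S₀).hom)
    (hdim : topologicalKrullDim ((baseChangeHom σ).obj S₀).left = 1)
    (p : ℕ) (A : complexBetti ((baseChangeHom σ).obj 𝒳₀) (2 * p))
    (hA : ∀ s : ComplexPoints ((baseChangeHom σ).obj S₀),
      IsRationalClass (complexBetti.map (fiberι ((baseChangeHom σ).map f₀) s) (2 * p) A) ∧
      IsOfHodgeType n (fiberOver ((baseChangeHom σ).map f₀) s) (2 * p) p p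
        (complexBetti.map (fiberι ((baseChangeHom σ).map f₀) s) (2 * p) A))
    (hs₀ : ∃ s₀ : ComplexPoints ((baseChangeHom σ).obj S₀),
      complexBetti.map (fiberι ((baseChangeHom σ).map f₀) s₀) (2 * p) A ∈
        algebraicClasses (fiberOver ((baseChangeHom σ).map f₀) s₀) p)
    (t : ComplexPoints ((baseChangeHom σ).obj S₀)) :
    complexBetti.map (fiberι ((baseChangeHom σ).map f₀) t) (2 * p) A ∈
      algebraicClasses (fiberOver ((baseChangeHom σ).map f₀) t) p := by
  obtain ⟨s₀, hs₀⟩ := hs₀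
  obtain ⟨p₀, hp₀⟩ := hP n
  obtain ⟨q, hq, κ, hκF, hκC, hκP, hκA, hκAlg, hκalg, 𝒴, ξ, s, ι, hNq, h𝒴, hgen, -, himp⟩ :=
    hS p₀ k σ f₀ hf hirr haff hsm hdim p A hA s₀ hs₀
  have halg : complexBetti.map (fiberι ((baseChangeHom σ).map f₀) s) (2 * p) A ∈
      algebraicClasses (fiberOver ((baseChangeHom σ).map f₀) s) p :=
    himp (hp₀ q hNq κ hκalg 𝒴 h𝒴 ξ)
  exact genericPropagation k σ f₀ hf hirr haff hsm hdim p A s hgen halg t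

/-- **P ∧ S ⟹ the crux over smooth irreducible affine CURVE bases** (`PadicDiscTransport.CurveResidual`,
unfolded): STUB D's kernel term `curveResidual_of_variationalHodgeDescended` (descent of the finitely
presented data to a countable subfield, EGA IV₃ 8.8.2 (ii); transport of hypotheses and conclusion along the
isomorphism of families) applied to `variationalHodgeDescended_of_padic`.
[cite: EGAIV3, Thm. 8.8.2 (ii)] [cite: MaulikPoonen2012, §3–4] -/
theorem curveResidual_of_padic ⦃n : ℕ⦄ ⦃𝒳 S : SchemeOver ℂ⦄ (f : 𝒳 ⟶ S)
    (hf : IsSmoothProjectiveFamily f n) (hirr : IrreducibleSpace S.left) (haff : IsAffine S.left)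
    (hsm : AlgebraicGeometry.Smooth S.hom) (hdim : topologicalKrullDim S.left = 1) (p : ℕ)
    (A : complexBetti 𝒳 (2 * p))
    (hA : ∀ s : ComplexPoints S, IsRationalClass (complexBetti.map (fiberι f s) (2 * p) A) ∧
      IsOfHodgeType n (fiberOver f s) (2 * p) p p (complexBetti.map (fiberι f s) (2 * p) A))
    (hs₀ : ∃ s₀ : ComplexPoints S,
      complexBetti.map (fiberι f s₀) (2 * p) A ∈ algebraicClasses (fiberOver f s₀) p)
    (s : ComplexPoints S) :
    complexBetti.map (fiberι f s) (2 * p) A ∈ algebraicClasses (fiberOver f s) p :=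
  curveResidual_of_variationalHodgeDescended
    (fun k _ _ σ _ _ _ f₀ hf' hirr' haff' hsm' hdim' p' A' hA' hs₀' t =>
      variationalHodgeDescended_of_padic hP hS k σ f₀ hf' hirr' haff' hsm' hdim' p' A' hA' hs₀' t)
    f hf hirr haff hsm hdim p A hA hs₀ s

/-- **P ∧ S ⟹ `Theses.AnchorTransport.VariationalHodge` — the crux BY NAME, with no residual binder.** The
registered line `padic-disc-transport` reduces Grothendieck's variational Hodge conjecture (global-class form,
proper smooth families with projective fibres over every smooth irreducible `ℂ`-scheme) to exactly its two
arithmetic stubs: the p-adic image-algebraization bet (AMMN 2022 Conj. 1.3, `K₀`-form; research-open) and the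
arithmetic disc. Route: the tree's unconditional reduction to smooth irreducible affine curve bases
(`variationalHodge_of_curveBase`, Mumford's curve lemma discharged by
`Motives.mumford_smoothCurve_through_two_points_holds`), then `curveResidual_of_padic`. This is the skeleton's
`VariationalHodge_of hD hG hP hS` with `hD`, `hG` the landed kernel terms.
[cite: AntieauMathewMorrowNikolaus2022, Conj. 1.3 and Thm. D] [cite: MaulikPoonen2012, §3–4]
[cite: CharlesSchnell2014Notes, Conj. 11.3.1] [cite: MumfordAV1970, §6 Lemma] -/
theorem variationalHodge_of_padic : VariationalHodge :=
  variationalHodge_of_curveBase mumford_smoothCurve_through_two_points_holds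
    fun _ _ _ f hf hirr haff hsm hdim p A hA hs₀ s =>
      curveResidual_of_padic hP hS f hf hirr haff hsm hdim p A hA hs₀ s

/-- **P ∧ S ⟹ `Ring2.Hypotheses.FlatSectionsAlgebraic`** (Charles–Schnell's Conj. 11.3.1 in flat-section
form over every smooth irreducible base; BINDER-OWNERS row b04, unrestricted), through the binder-free
`Ring2.Hypotheses.flatSectionsAlgebraic_of_vhc` (the partie fixe is needed only over affine curves, where it is
topological). [cite: CharlesSchnell2014Notes, Conj. 11.3.1 and Prop. 11.3.5]
[cite: AntieauMathewMorrowNikolaus2022, Conj. 1.3 and Thm. D] -/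
theorem flatSectionsAlgebraic_of_padic : Ring2.Hypotheses.FlatSectionsAlgebraic :=
  Ring2.Hypotheses.flatSectionsAlgebraic_of_vhc (variationalHodge_of_padic hP hS)

end Padic

end Summit.HodgeConjecture.HodgeConjecture.Theorems

end
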